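import Summits.BirchSwinnertonDyer.BirchSwinnertonDyer.Theorems.UniversalToricDescentTwinTowerSigmaProduct
import Summits.BirchSwinnertonDyer.BirchSwinnertonDyer.Theorems.UniversalToricDescentLocalH1Corank
import Summits.BirchSwinnertonDyer.BirchSwinnertonDyer.Theorems.UniversalToricDescentSigmaLocalFinite
import Summits.BirchSwinnertonDyer.Rank1Residual.X2.NonPrimitiveQuotientCorank
import Literature.NumberTheory.EllipticCurves.SelmerCorankProofs
import HarnessLib

/-!
# Route UniversalToricDescent — the `ℤ_p`-CORANK of `Sel_𝔭^{Σ₀∪T}(K_∞, E[p^∞]) / Sel_𝔭^{Σ₀}` from the `Σ`-local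
# surjectivity (Greenberg–Vatsal Cor. 2.3) ALONE: `corank = Σ_{v∈T} p^{c_v} · s_v` — no divisibility, no (N′)

Lead prover bsd-wall-utd-p1 g16 (`--supports` ♭T′ stmt-BirchSwinnertonDyer-26975; ONE-SIDED glue G≤ of skeleton v4a, line
`sigmacongruence`). g14's `natCard_quotient_pTorsion_eq_prod_of_surj` (file `…TwinTowerSigmaProduct`) counts
`#(Sel^{Σ₀∪T}/Sel^{Σ₀})[p]` and needs the `p`-DIVISIBILITY of every intermediate Selmer group — for the rank-free twin this came
from «no non-zero finite `Λ`-submodule» (N′), the input the one-sided crux ♭T≤ avoids. The one-sided defect transport only needs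
the `ℤ_p`-CORANK of the quotient (it enters `λ(X^{Σ₀∪T}) = λ(X^{Σ₀}) + corank`, Eisenstein cell's
`lambdaInvariant_eq_add_zpCorank_of_muInvariant_eq_zero`), and coranks are ADDITIVE on short exact sequences with no
divisibility hypothesis (`zpCorank_eq_add_of_shortExact`):

* `zpCorank_quotient_insert_eq_add_of_surj` — one place: `corank(Sel^{Σ∪{v}}/Sel^{Σ′}) = corank(Sel^{Σ}/Sel^{Σ′}) +
  p^{c} · s_v` along `0 → Sel^Σ/Sel^{Σ′} → Sel^{Σ∪{v}}/Sel^{Σ′} → Sel^{Σ∪{v}}/Sel^Σ ≅ H¹(H ∩ D_v, E[p^∞])^{p^c} → 0` (the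
  isomorphism is g14's `natCard_quotient_pTorsion_eq_pow_of_surj`, from the tuple surjectivity at `v`), with
  `corank H¹(H ∩ D_v, E[p^∞]) = s_v` read off `#H¹(H ∩ D_v, E[p^∞])[p] = p^{s_v}` (g11 `zpCorank_subgroupH1_kerD_eq`);
* **`finite_and_zpCorank_quotient_eq_sum_of_surj`** — over a finite set `T` of finitely decomposed places `v ∤ p`, `v ∉ Σ₀`
  with exact indices `p^{c_v}`, GIVEN the tuple surjectivity at every `v ∈ T` out of every intermediate `Sel^{Σ₀∪T′∪{v}}`:
  `(Sel^{Σ₀∪T}/Sel^{Σ₀})[p]` is finite and **`corank_{ℤ_p}(Sel_𝔭^{Σ₀∪T}/Sel_𝔭^{Σ₀}) = Σ_{v∈T} p^{c_v} · s_v`**.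

HONEST STATUS: helper theorems (the twin's `Σ`-local surjectivity stays a hypothesis — stub TS2′). THEOREMS ONLY; no definition,
no named fact, no `sorry`. BSD is not advanced by this file.
References: [GreenbergVatsal2000] §2 Cor. (2.3), Prop. (2.4), (2.10) (pp. 24–28); [Greenberg1999] §1 p. 60 (coranks).
-/

set_option autoImplicit false
-- `…BirchSwinnertonDyer.BirchSwinnertonDyer.Theorems…` is the problem's mandated namespace (D-0017).
set_option linter.dupNamespace false
noncomputable section
open scoped Classical AddSubgroup
namespace Summit.BirchSwinnertonDyer.BirchSwinnertonDyer.Theorems.UniversalToricDescentSigmaLocalImage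
open CategoryTheory Function Field NumberField IsDedekindDomain WeierstrassCurve
open Literature.NumberTheory.GaloisRepresentations Literature.NumberTheory.EllipticCurves
  Literature.NumberTheory.EllipticCurves.GreenbergSelmer Literature.NumberTheory.GaloisCohomology
  Literature.NumberTheory.EllipticCurves.Rank1Residual
  Summit.BirchSwinnertonDyer.Rank1Residual Summit.BirchSwinnertonDyer.Rank1Residual.X11b
  Summit.BirchSwinnertonDyer.Rank1Residual.X11b.Coinv Summit.BirchSwinnertonDyer.Rank1Residual.X11b.LocBridge
  Summit.BirchSwinnertonDyer.Rank1Residual.X11b.AcSelmer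
  Summit.BirchSwinnertonDyer.BirchSwinnertonDyer.Theorems.UniversalToricDescentSigmaCoinvariants
  Summit.BirchSwinnertonDyer.BirchSwinnertonDyer.Theorems.UniversalToricDescentSigmaLocalStabilizer
  Summit.BirchSwinnertonDyer.BirchSwinnertonDyer.Theorems.UniversalToricDescentLocalH1Divisible

variable {K : Type} [Field K] [NumberField K] (W : WeierstrassCurve K) [W.IsElliptic] (p : ℕ) [hp : Fact p.Prime]
  (κ : ZpExtension K p)

/-! ### §1 A three-subgroup short exact sequence `0 → M/N → L/N → L/M → 0` -/

section ThreeSubgroups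
variable {G : Type*} [AddCommGroup G] {N M L : AddSubgroup G}

/-- The inclusion `M/N → L/N` for `N ≤ M ≤ L`. [folklore] -/
theorem injective_quotientMapOfLe (hNM : N ≤ M) (hML : M ≤ L) :
    Function.Injective (QuotientAddGroup.map (N.addSubgroupOf M) (N.addSubgroupOf L) (AddSubgroup.inclusion hML)
      (fun _ hx ↦ AddSubgroup.mem_addSubgroupOf.mpr (AddSubgroup.mem_addSubgroupOf.mp hx))) := by
  have _ := hNM
  rw [injective_iff_map_eq_zero]
  intro x hx
  induction x using QuotientAddGroup.induction_on with
  | H m =>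
    rw [QuotientAddGroup.map_mk, QuotientAddGroup.eq_zero_iff, AddSubgroup.mem_addSubgroupOf,
      AddSubgroup.coe_inclusion] at hx
    exact (QuotientAddGroup.eq_zero_iff m).mpr (AddSubgroup.mem_addSubgroupOf.mpr hx)

/-- The projection `L/N → L/M` for `N ≤ M ≤ L` is onto. [folklore] -/
theorem surjective_quotientMapOfLe (hNM : N ≤ M) :
    Function.Surjective (QuotientAddGroup.map (N.addSubgroupOf L) (M.addSubgroupOf L) (AddMonoidHom.id L)
      (fun _ hx ↦ AddSubgroup.mem_addSubgroupOf.mpr (hNM (AddSubgroup.mem_addSubgroupOf.mp hx)))) :=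
  QuotientAddGroup.map_surjective_of_surjective _ _ _ QuotientAddGroup.mk_surjective _

/-- Exactness at `L/N`: the kernel of `L/N → L/M` is the image of `M/N`. [folklore] -/
theorem exact_quotientMapOfLe (hNM : N ≤ M) (hML : M ≤ L) (b : L ⧸ N.addSubgroupOf L)
    (hb : QuotientAddGroup.map (N.addSubgroupOf L) (M.addSubgroupOf L) (AddMonoidHom.id L)
      (fun _ hx ↦ AddSubgroup.mem_addSubgroupOf.mpr (hNM (AddSubgroup.mem_addSubgroupOf.mp hx))) b = 0) :
    b ∈ (QuotientAddGroup.map (N.addSubgroupOf M) (N.addSubgroupOf L) (AddSubgroup.inclusion hML)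
      (fun _ hx ↦ AddSubgroup.mem_addSubgroupOf.mpr (AddSubgroup.mem_addSubgroupOf.mp hx))).range := by
  induction b using QuotientAddGroup.induction_on with
  | H l =>
    rw [QuotientAddGroup.map_mk, AddMonoidHom.id_apply, QuotientAddGroup.eq_zero_iff, AddSubgroup.mem_addSubgroupOf] at hb
    exact ⟨QuotientAddGroup.mk ⟨(l : G), hb⟩, by rw [QuotientAddGroup.map_mk]; rfl⟩

/-- The composite `M/N → L/N → L/M` is zero. [folklore] -/
theorem comp_quotientMapOfLe_eq_zero (hNM : N ≤ M) (hML : M ≤ L) (a : M ⧸ N.addSubgroupOf M) :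
    QuotientAddGroup.map (N.addSubgroupOf L) (M.addSubgroupOf L) (AddMonoidHom.id L)
      (fun _ hx ↦ AddSubgroup.mem_addSubgroupOf.mpr (hNM (AddSubgroup.mem_addSubgroupOf.mp hx)))
      (QuotientAddGroup.map (N.addSubgroupOf M) (N.addSubgroupOf L) (AddSubgroup.inclusion hML)
        (fun _ hx ↦ AddSubgroup.mem_addSubgroupOf.mpr (AddSubgroup.mem_addSubgroupOf.mp hx)) a) = 0 := by
  induction a using QuotientAddGroup.induction_on with
  | H m =>
    rw [QuotientAddGroup.map_mk, QuotientAddGroup.map_mk, AddMonoidHom.id_apply, QuotientAddGroup.eq_zero_iff,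
      AddSubgroup.mem_addSubgroupOf, AddSubgroup.coe_inclusion]
    exact m.2

/-- **Corank additivity along `0 → M/N → L/N → L/M → 0`** (generic abelian groups, `N ≤ M ≤ L ≤ G`): if `L/N` is
`p`-primary, `(M/N)[p]` is finite and `L/M ≃+ C` with `C[p]` finite, then `(L/N)[p]` is finite and
`corank(L/N) = corank(M/N) + corank C`. [cite: Greenberg1999, §1 p. 60] -/
theorem finite_and_zpCorank_quotient_eq_add_of_addEquiv (hNM : N ≤ M) (hML : M ≤ L)
    (hL : ∀ x : L ⧸ N.addSubgroupOf L, ∃ n : ℕ, p ^ n • x = 0)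
    [Finite ((↥M ⧸ N.addSubgroupOf M)[(p : ℤ)])]
    {C : Type*} [AddCommGroup C] (e : (↥L ⧸ M.addSubgroupOf L) ≃+ C) [Finite (C[(p : ℤ)])] :
    Finite ((↥L ⧸ N.addSubgroupOf L)[(p : ℤ)]) ∧
      zpCorank (↥L ⧸ N.addSubgroupOf L) p = zpCorank (↥M ⧸ N.addSubgroupOf M) p + zpCorank C p := by
  have hi := injective_quotientMapOfLe (N := N) (M := M) (L := L) hNM hML
  have hf := surjective_quotientMapOfLe (N := N) (M := M) (L := L) hNM
  have hex := exact_quotientMapOfLe (N := N) (M := M) (L := L) hNM hML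
  have hfi := comp_quotientMapOfLe_eq_zero (N := N) (M := M) (L := L) hNM hML
  -- `p`-primarity of the outer terms from that of `L/N`
  have hA : ∀ x : ↥M ⧸ N.addSubgroupOf M, ∃ n : ℕ, p ^ n • x = 0 := fun x ↦ by
    obtain ⟨n, hn⟩ := hL (QuotientAddGroup.map (N.addSubgroupOf M) (N.addSubgroupOf L) (AddSubgroup.inclusion hML)
      (fun _ hx ↦ AddSubgroup.mem_addSubgroupOf.mpr (AddSubgroup.mem_addSubgroupOf.mp hx)) x)
    exact ⟨n, hi (by rw [map_nsmul, hn, map_zero])⟩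
  have hC' : ∀ x : ↥L ⧸ M.addSubgroupOf L, ∃ n : ℕ, p ^ n • x = 0 := fun x ↦ by
    obtain ⟨y, rfl⟩ := hf x
    obtain ⟨n, hn⟩ := hL y
    exact ⟨n, by rw [← map_nsmul, hn, map_zero]⟩
  haveI : Finite ((↥L ⧸ M.addSubgroupOf L)[(p : ℤ)]) := Finite.of_equiv _ (torsionByEquiv e p).symm.toEquiv
  obtain ⟨hB, hBfin⟩ := primary_and_finite_torsionBy_of_shortExact (p := p) hi hex hfi hA hC'
  haveI := hBfin
  refine ⟨hBfin, ?_⟩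
  rw [zpCorank_eq_add_of_shortExact (p := p) hi hf hex hfi hB, zpCorank_congr e p]

end ThreeSubgroups

/-! ### §2 One place: `corank(Sel^{Σ∪{v}}/Sel^{Σ′}) = corank(Sel^{Σ}/Sel^{Σ′}) + p^{c}·s_v` -/

omit [W.IsElliptic] in
/-- `Sel_𝔭^Σ(K_∞, E[p^∞])` and all its subquotients are `p`-primary. [folklore] -/
theorem quotient_selmerAc_isPrimary (𝔭 : HeightOneSpectrum (𝓞 K)) {S S' : Set (HeightOneSpectrum (𝓞 K))}
    (b : selmerAc W p κ 𝔭 S' ⧸ (selmerAc W p κ 𝔭 S).addSubgroupOf (selmerAc W p κ 𝔭 S')) :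
    ∃ n : ℕ, p ^ n • b = 0 := by
  induction b using QuotientAddGroup.induction_on with
  | H s =>
    obtain ⟨k, hk⟩ := selmerAc_exists_pow_smul_eq_zero W p κ 𝔭 S' s
    exact ⟨k, by rw [← QuotientAddGroup.mk_nsmul, hk, QuotientAddGroup.mk_zero]⟩

set_option maxHeartbeats 400000 in
/-- **One place.** For `Σ′ ⊆ Σ`, `v ∤ p`, `v ∉ Σ` finitely decomposed with exact index `κ(D_v) = p^c ℤ_p` and
`#H¹(H ∩ D_v, E[p^∞])[p] = p^{s}`, GIVEN the tuple surjectivity at `v` out of `Sel^{Σ∪{v}}`: if `(Sel^Σ/Sel^{Σ′})[p]` is finite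
then so is `(Sel^{Σ∪{v}}/Sel^{Σ′})[p]` and `corank(Sel^{Σ∪{v}}/Sel^{Σ′}) = corank(Sel^Σ/Sel^{Σ′}) + p^c · s` (additivity of
coranks along `0 → Sel^Σ/Sel^{Σ′} → Sel^{Σ∪{v}}/Sel^{Σ′} → Sel^{Σ∪{v}}/Sel^Σ → 0`, the last group being
`≅ H¹(H ∩ D_v, E[p^∞])^{p^c}` of corank `p^c · s`). [cite: GreenbergVatsal2000, §2 Cor. (2.3), Prop. (2.4) (pp. 24–26)]
[cite: Greenberg1999, §1 p. 60] -/
theorem finite_and_zpCorank_quotient_insert_eq_add_of_surj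
    {𝔭 : HeightOneSpectrum (𝓞 K)} {γ : absoluteGaloisGroup K} (hγ : κ.IsTopGenerator γ)
    {S' S : Set (HeightOneSpectrum (𝓞 K))} (hS'S : S' ⊆ S)
    {v : HeightOneSpectrum (𝓞 K)} (hpv : ((p : ℕ) : 𝓞 K) ∉ v.asIdeal) (hvS : v ∉ S)
    (hvdec : ¬ (decomp v ≤ κ.kerSubgroup)) {c s : ℕ}
    (hc : ∀ z : ℤ_[p], ∃ d : decomp (K := K) v, (κ (d : absoluteGaloisGroup K)).toAdd = (p : ℤ_[p]) ^ c * z)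
    (hs : Nat.card {f : subgroupH1 (kerD κ v) (W.geomPrimaryTorsion p) // p • f = 0} = p ^ s)
    (hsurj : ∀ f : Fin (p ^ c) → subgroupH1 (kerD κ v) (W.geomPrimaryTorsion p),
      ∃ t ∈ selmerAc W p κ 𝔭 (insert v S), ∀ i : Fin (p ^ c),
        resKerD κ (W.geomPrimaryTorsion p) v (W.conjH1 p κ.kerSubgroup (γ ^ (i : ℕ)) t) = f i)
    [Finite ((↥(selmerAc W p κ 𝔭 S) ⧸ (selmerAc W p κ 𝔭 S').addSubgroupOf (selmerAc W p κ 𝔭 S))[(p : ℤ)])] :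
    Finite ((↥(selmerAc W p κ 𝔭 (insert v S)) ⧸
        (selmerAc W p κ 𝔭 S').addSubgroupOf (selmerAc W p κ 𝔭 (insert v S)))[(p : ℤ)]) ∧
      zpCorank (↥(selmerAc W p κ 𝔭 (insert v S)) ⧸
          (selmerAc W p κ 𝔭 S').addSubgroupOf (selmerAc W p κ 𝔭 (insert v S))) p =
        zpCorank (↥(selmerAc W p κ 𝔭 S) ⧸ (selmerAc W p κ 𝔭 S').addSubgroupOf (selmerAc W p κ 𝔭 S)) p + p ^ c * s := by
  have hpr : p.Prime := hp.out
  have hNM : selmerAc W p κ 𝔭 S' ≤ selmerAc W p κ 𝔭 S := selmerOver_mono hS'S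
  have hML : selmerAc W p κ 𝔭 S ≤ selmerAc W p κ 𝔭 (insert v S) := selmerOver_mono (Set.subset_insert _ _)
  -- the local group: `p`-primary, finite `p`-torsion, corank `s`
  have htor : ∀ m : W.geomPrimaryTorsion p, ∃ k : ℕ, p ^ k • m = 0 := fun m ↦ by
    obtain ⟨k, hk⟩ := m.2
    exact ⟨k, Subtype.ext (by rw [AddSubgroupClass.coe_nsmul]; exact hk)⟩
  have hA : ∀ a : subgroupH1 (kerD κ v) (W.geomPrimaryTorsion p), ∃ n : ℕ, p ^ n • a = 0 := fun a ↦
    exists_pow_smul_kerD_eq_zero κ htor v a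
  have eA : Nat.card ((subgroupH1 (kerD κ v) (W.geomPrimaryTorsion p))[(p : ℤ)]) =
      Nat.card {f : subgroupH1 (kerD κ v) (W.geomPrimaryTorsion p) // p • f = 0} :=
    Nat.card_congr (Equiv.subtypeEquivRight fun a ↦ AddSubgroup.torsionBy.nsmul_iff)
  haveI hAfin : Finite ((subgroupH1 (kerD κ v) (W.geomPrimaryTorsion p))[(p : ℤ)]) := by
    apply Nat.finite_of_card_ne_zero
    rw [eA, hs]
    exact pow_ne_zero s hpr.ne_zero
  have hAcork : zpCorank (subgroupH1 (kerD κ v) (W.geomPrimaryTorsion p)) p = s :=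
    zpCorank_subgroupH1_kerD_eq W κ (by exact_mod_cast hpv) hvdec hs
  haveI : Finite ((Fin (p ^ c) → subgroupH1 (kerD κ v) (W.geomPrimaryTorsion p))[(p : ℤ)]) :=
    Rank1Residual.X2.NonPrimitiveQuotientCorank.finite_torsionBy_pi (p := p)
  have hCcork : zpCorank (Fin (p ^ c) → subgroupH1 (kerD κ v) (W.geomPrimaryTorsion p)) p = p ^ c * s := by
    rw [Rank1Residual.X2.NonPrimitiveQuotientCorank.zpCorank_pi (p := p) (fun _ ↦ hA), Finset.sum_const,
      Finset.card_univ, Fintype.card_fin, smul_eq_mul, hAcork]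
  -- `Sel^{Σ∪{v}}/Sel^Σ ≅ H¹(H ∩ D_v, E[p^∞])^{p^c}` (tuple surjectivity) and the generic additivity
  obtain ⟨⟨e⟩, -⟩ := natCard_quotient_pTorsion_eq_pow_of_surj W p κ hγ hpv hvS hc hsurj
  obtain ⟨hfin, hcork⟩ := finite_and_zpCorank_quotient_eq_add_of_addEquiv p hNM hML
    (quotient_selmerAc_isPrimary W p κ 𝔭) e
  exact ⟨hfin, by rw [hcork, hCcork]⟩

/-! ### §3 The finite set of places: `corank(Sel^{Σ₀∪T}/Sel^{Σ₀}) = Σ_{v∈T} p^{c_v}·s_v` -/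

/-- **`corank_{ℤ_p}(Sel_𝔭^{Σ₀∪T}(K_∞, E[p^∞])/Sel_𝔭^{Σ₀}) = Σ_{v∈T} p^{c_v} · s_v`** (and the `p`-torsion of the quotient is
finite) for a finite set `T` of finitely decomposed places `v ∤ p`, `v ∉ Σ₀`, with exact indices `κ(D_v) = p^{c_v}ℤ_p` and
local counts `#H¹(H ∩ D_v, E[p^∞])[p] = p^{s_v}`, GIVEN the tuple surjectivity at every `v ∈ T` out of every intermediate
`Sel^{Σ₀∪T′∪{v}}` (`hsurj`; for the rank-free twin: stub TS2′ via `exists_mem_forall_fin_of_forall_sig`). Induction on `T`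
by §2; NO divisibility of the intermediate Selmer groups is needed (contrast `natCard_quotient_pTorsion_eq_prod_of_surj`).
[cite: GreenbergVatsal2000, §2 Cor. (2.3), Prop. (2.4) and (2.10) (pp. 24–28)] [cite: Greenberg1999, §1 p. 60] -/
theorem finite_and_zpCorank_quotient_eq_sum_of_surj
    {𝔭 : HeightOneSpectrum (𝓞 K)} {γ : absoluteGaloisGroup K} (hγ : κ.IsTopGenerator γ) (S₀ : Set (HeightOneSpectrum (𝓞 K)))
    (c s : HeightOneSpectrum (𝓞 K) → ℕ) (T : Finset (HeightOneSpectrum (𝓞 K)))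
    (hTp : ∀ v ∈ T, ((p : ℕ) : 𝓞 K) ∉ v.asIdeal) (hTS : ∀ v ∈ T, v ∉ S₀)
    (hTdec : ∀ v ∈ T, ¬ (decomp v ≤ κ.kerSubgroup))
    (hc : ∀ v ∈ T, ∀ z : ℤ_[p], ∃ d : decomp (K := K) v,
      (κ (d : absoluteGaloisGroup K)).toAdd = (p : ℤ_[p]) ^ c v * z)
    (hs : ∀ v ∈ T, Nat.card {f : subgroupH1 (kerD κ v) (W.geomPrimaryTorsion p) // p • f = 0} = p ^ s v)
    (hsurj : ∀ v ∈ T, ∀ S : Set (HeightOneSpectrum (𝓞 K)), S₀ ⊆ S → S ⊆ S₀ ∪ ↑T → v ∉ S →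
      ∀ f : Fin (p ^ c v) → subgroupH1 (kerD κ v) (W.geomPrimaryTorsion p),
        ∃ t ∈ selmerAc W p κ 𝔭 (insert v S), ∀ i : Fin (p ^ c v),
          resKerD κ (W.geomPrimaryTorsion p) v (W.conjH1 p κ.kerSubgroup (γ ^ (i : ℕ)) t) = f i) :
    Finite ((↥(selmerAc W p κ 𝔭 (S₀ ∪ ↑T)) ⧸
        (selmerAc W p κ 𝔭 S₀).addSubgroupOf (selmerAc W p κ 𝔭 (S₀ ∪ ↑T)))[(p : ℤ)]) ∧
      zpCorank (↥(selmerAc W p κ 𝔭 (S₀ ∪ ↑T)) ⧸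
          (selmerAc W p κ 𝔭 S₀).addSubgroupOf (selmerAc W p κ 𝔭 (S₀ ∪ ↑T))) p = ∑ v ∈ T, p ^ c v * s v := by
  induction T using Finset.induction_on with
  | empty =>
    rw [Finset.sum_empty]
    haveI : Subsingleton (↥(selmerAc W p κ 𝔭 (S₀ ∪ ↑(∅ : Finset (HeightOneSpectrum (𝓞 K))))) ⧸
        (selmerAc W p κ 𝔭 S₀).addSubgroupOf (selmerAc W p κ 𝔭 (S₀ ∪ ↑(∅ : Finset (HeightOneSpectrum (𝓞 K)))))) :=
      ⟨fun a b ↦ by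
        induction a using QuotientAddGroup.induction_on with | H a =>
        induction b using QuotientAddGroup.induction_on with | H b =>
        refine QuotientAddGroup.eq.mpr (AddSubgroup.mem_addSubgroupOf.mpr ?_)
        exact selmerOver_mono (by simp) (-a + b).2⟩
    exact ⟨inferInstance, zpCorank_of_finite_eq_zero p⟩
  | @insert v T hvT ih =>
    have hTsub : T ⊆ insert v T := Finset.subset_insert v T
    obtain ⟨ihfin, ihcork⟩ := ih (fun w hw ↦ hTp w (hTsub hw)) (fun w hw ↦ hTS w (hTsub hw))
      (fun w hw ↦ hTdec w (hTsub hw)) (fun w hw ↦ hc w (hTsub hw)) (fun w hw ↦ hs w (hTsub hw))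
      (fun w hw S h₀ hS hwS ↦ hsurj w (hTsub hw) S h₀
        (hS.trans (Set.union_subset_union_right S₀ (Finset.coe_subset.mpr hTsub))) hwS)
    haveI := ihfin
    have hvS : v ∉ S₀ ∪ ↑T := by
      rintro (h | h)
      · exact hTS v (Finset.mem_insert_self v T) h
      · exact hvT (Finset.mem_coe.mp h)
    rw [Finset.sum_insert hvT, Finset.coe_insert, Set.union_insert]
    have hv := Finset.mem_insert_self v T
    obtain ⟨hfin, hcork⟩ := finite_and_zpCorank_quotient_insert_eq_add_of_surj W p κ hγ
      (Set.subset_union_left : S₀ ⊆ S₀ ∪ ↑T) (hTp v hv) hvS (hTdec v hv) (hc v hv) (hs v hv)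
      (hsurj v hv (S₀ ∪ ↑T) Set.subset_union_left
        (Set.union_subset_union_right S₀ (Finset.coe_subset.mpr hTsub)) hvS)
    exact ⟨hfin, by rw [hcork, ihcork, add_comm]⟩

end Summit.BirchSwinnertonDyer.BirchSwinnertonDyer.Theorems.UniversalToricDescentSigmaLocalImage

end
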